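import Literature.NumberTheory.Rogawski1990.ArchExplicitTransferFactor       -- ★ `archExplicitDelta`, §7 `_conj` lemmas (`Δ″_∞ = τ · D_{G∕H,∞} · Π κ_w`)
import Literature.NumberTheory.Rogawski1990.EndoscopicClassTransfer          -- ★ `EndoMatches.of_isStablyConjH_left`
import Literature.NumberTheory.Automorphic.ArchEndoscopicCartanAtlas          -- ★ (T-ATLAS) `endoTorus S c`, `endoBlock`, `endoCircle`, `hypBlockGL`
import Literature.NumberTheory.Automorphic.ArchCartanCoordinates              -- ★ (COORD) `ArchCartan.flipAt`, `ArchCartan.negXAt`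
import Literature.NumberTheory.Automorphic.ArchEndoscopicChartOrbWeyl           -- ★ (W-real) LH2-p04: `det_swapTwo_ne_zero`, `swapGL_inv`, `swapGL_conj_hypBlockGL` (the swap `J` of `U(Φ₂)_w`)
import HarnessLib

/-!
# `Δ″_∞` is constant on STABLE classes of `γ_H` (Rogawski 1990 §4.9 p. 55, §14.6 p. 242; Langlands–Shelstad 1987 §1)

Topic `NumberTheory/Rogawski1990`; namespace `Literature.NumberTheory.Rogawski1990`.  THEOREMS ONLY (no `def`, no instance, no notation, no axiom, no named
fact, no `sorry`).  Cell `pub/hodgecm-mathlib`, line LH3 (closer stub `stub_N9`, crux H413 = `stmt-HodgeConjecture-24833`), DIRECT ROAD brick **(Δ-STABLE)**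
(LH3-plan (g2) 2026-09-02T06:18:04Z; pen LH10-p02 (g3)).  HONEST LABEL: HC_CM is proved only modulo the 7 printed citations (2 remaining: hLiu418 =
stmt-HodgeConjecture-24832, h413 = stmt-HodgeConjecture-24833) until rung 0 closes; count-neutral kit for the (W)-clause of `stub_N9`'s direct road.

THE POINT.  Rogawski's explicit archimedean factor ★ `archExplicitDelta L H′ γ_H μ γ′ = τ(γ_H) · D_{G∕H,∞}(γ_H) · Π_w κ_w(γ_H, γ′)` (on matching pairs, `0` off them)
reads `γ_H = (g, u) ∈ H_∞ = U(Φ₂)(L⁺ ⊗ ℝ) × U(Φ₁)(L⁺ ⊗ ℝ)` ONLY through `γ₂ = u` (a `1 × 1` matrix: a `GL₁`-conjugacy invariant), the characteristic polynomial `χ_g` and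
`det g⁻¹` of the `U(Φ₂)`-part (both `GL₂(L ⊗ ℝ)`-conjugacy invariants), and the matching relation `ι(γ_H) ↔ γ′`, which only sees the `GL₃(L ⊗ ℝ)`-class of `ι(γ_H)`
(★ `EndoMatches.of_isStablyConjH_left`).  Hence `Δ″_∞(γ_H′, γ′) = Δ″_∞(γ_H, γ′)` whenever `γ_H ∼_st γ_H′` in `H_∞` (★ `IsArchStablyConjH` = componentwise conjugacy in
`GL₂(L ⊗ ℝ) × GL₁(L ⊗ ℝ)`) — §1, extending the `H_∞`-CONJUGACY invariance ★ `archExplicitDelta_conj_left` (§7 of ★ `ArchExplicitTransferFactor`) verbatim.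
§2 reads this on the Cartan atlas ★ `endoTorus S c` of (T-ATLAS): the non-realised Weyl flip `θ₀ ↔ θ₂` of the compact `U(Φ₂)_w`-block (`w ∉ S`, ★ `ArchCartan.flipAt`) and
the real reflection `x ↦ −x` of the split block (`w ∈ S`, ★ `ArchCartan.negXAt`) both move `endoTorus S c` inside its stable class (the two eigenvalues of the
`2`-block are swapped by a `GL₂(ℂ)`-conjugation at `w`, nothing moves elsewhere), so `Δ″_∞` is invariant under both.  Print: «`Δ_{G∕H}` depends only on the stable
conjugacy class of `γ`» is implicit in [Rogawski1990 §4.9 p. 55] (`τ`, `D_{G∕H}` are functions of the eigenvalues) and is the transfer-factor axiom of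
[LanglandsShelstad1987 §1] («`Δ(γ_H, γ)` depends only on the stable conjugacy class of `γ_H`»).

WHAT IS PROVED.  §1 (any `a ∼_st a′` in `H_∞`): `archGammaTwo_of_isArchStablyConjH`, `archCharpolyTwo_of_isArchStablyConjH`, `archDetInvFst_of_isArchStablyConjH`,
`archTauArg_…`, `archTau_…`, `archWeylRatio_…`, `archEigenlineProjector_…`, `archKappaAt_…`, `isArchNormPair_iff_of_isArchStablyConjH`, and the head
**`archExplicitDelta_of_isArchStablyConjH (h : IsArchStablyConjH L a a′) (μ) (b) : archExplicitDelta L H′ a′ μ b = archExplicitDelta L H′ a μ b`**.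
§2 (atlas): `swapGL_conj_circleDiagonal_two` (compact twin of ★ `swapGL_conj_hypBlockGL`), `endoCircle_congr`∕`endoBlock_congr`, `endoCircle_flipAt`, `endoCircle_negXAt`,
`isStablyConj_endoBlock_flipAt`, `isStablyConj_endoBlock_negXAt`,
`isArchStablyConjH_endoTorus_flipAt (hw : w ∉ S)`, `isArchStablyConjH_endoTorus_negXAt (hw : w ∈ S)`, and the corollaries
**`archExplicitDelta_endoTorus_flipAt`**, **`archExplicitDelta_endoTorus_negXAt`**.  Consumers: (W) `archBzWeyl_transfFam` (LH7-p02 ED. 2), `chartOrbH_negXAt` ∕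
`chartOrbG_negXAt` (LH2-p04 ∕ LH3-p02), O-L2 of the LH3 skeleton.

## References
* [Rogawski1990] J. D. Rogawski, *Automorphic Representations of Unitary Groups in Three Variables*, Ann. of Math. Stud. 123 (1990): §4.9 p. 55 (`τ`, `D_{G∕H}`,
  `Δ_{G∕H}`), §14.6 p. 242 (`Δ″_v`, `κ = ±1`), §3.1 p. 19 (stable conjugacy), §4.3 p. 42 (`ι(γ_H)`).
* [LanglandsShelstad1987] R. P. Langlands, D. Shelstad, *On the definition of transfer factors*, Math. Ann. 278 (1987), §1 (dependence on the stable class of `γ_H`).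
* [Shelstad1979] D. Shelstad, *Characters and inner forms of a quasi-split group over ℝ*, Compositio Math. 39 (1979), §4 p. 23 (the Weyl reflections of the Cartan
  subgroups of `U(1,1)`).
-/

set_option autoImplicit false

noncomputable section

open NumberField NumberField.InfinitePlace IsDedekindDomain Matrix Polynomial Complex
open Literature.NumberTheory.GaloisRepresentations
open scoped MatrixGroups ComplexOrder

namespace Literature.NumberTheory.Rogawski1990

open Literature.NumberTheory.Automorphic Literature.NumberTheory.Automorphic.UnitaryGroup

/-! ## §1 `Δ″_∞(γ_H, γ′)` depends on `γ_H` only through its stable class -/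

section Stable

variable (L : Type) [Field L] [NumberField L] [IsCMField L] (H' : Matrix (Fin 3) (Fin 3) L)
  {a a' : ↥(UnitaryGroup.arch (↥(maximalRealSubfield L)) L (IsCMField.complexConj L) 2
      (Matrix.of fun i j : Fin 2 => if i.val + j.val + 1 = 2 then (1 : L) else 0)) ×
    ↥(UnitaryGroup.arch (↥(maximalRealSubfield L)) L (IsCMField.complexConj L) 1
      (Matrix.of fun i j : Fin 1 => if i.val + j.val + 1 = 1 then (1 : L) else 0))}

/-- `γ₂` is constant on stable classes of `H_∞` (the `U(Φ₁)`-coordinate is a `1 × 1` matrix: `γ₂ = det`, a `GL₁`-conjugacy invariant). [cite: Rogawski1990, §4.9 p. 55] -/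
theorem archGammaTwo_of_isArchStablyConjH (h : IsArchStablyConjH L a a') : archGammaTwo L a' = archGammaTwo L a := by
  obtain ⟨g, hg⟩ := isStablyConj_iff.1 h.2
  unfold archGammaTwo
  rw [← hg, Units.val_mul, Units.val_mul]
  have e1 := Matrix.det_fin_one ((g : GL (Fin 1) (mixedEmbedding.mixedSpace L)).val * (a.2 : GL (Fin 1) (mixedEmbedding.mixedSpace L)).val *
    (g⁻¹ : GL (Fin 1) (mixedEmbedding.mixedSpace L)).val)
  have e2 := Matrix.det_fin_one ((a.2 : GL (Fin 1) (mixedEmbedding.mixedSpace L)).val)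
  rw [← e1, ← e2, Matrix.det_units_conj]

/-- `χ_g` is constant on stable classes of `H_∞` (★ `IsStablyConj.charpoly_eq`). [cite: Rogawski1990, §4.9 p. 55; §3.1 p. 19] -/
theorem archCharpolyTwo_of_isArchStablyConjH (h : IsArchStablyConjH L a a') : archCharpolyTwo L a' = archCharpolyTwo L a := by
  unfold archCharpolyTwo
  exact (IsStablyConj.charpoly_eq h.1).symm

/-- `det g⁻¹` is constant on stable classes of `H_∞`. [cite: Rogawski1990, §4.9 p. 55] -/
theorem archDetInvFst_of_isArchStablyConjH (h : IsArchStablyConjH L a a') :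
    ((((a'.1 : ↥(UnitaryGroup.arch (↥(maximalRealSubfield L)) L (IsCMField.complexConj L) 2
        (Matrix.of fun i j : Fin 2 => if i.val + j.val + 1 = 2 then (1 : L) else 0))) : GL (Fin 2) (mixedEmbedding.mixedSpace L))⁻¹ :
        GL (Fin 2) (mixedEmbedding.mixedSpace L)) : Matrix (Fin 2) (Fin 2) (mixedEmbedding.mixedSpace L)).det =
      ((((a.1 : ↥(UnitaryGroup.arch (↥(maximalRealSubfield L)) L (IsCMField.complexConj L) 2
        (Matrix.of fun i j : Fin 2 => if i.val + j.val + 1 = 2 then (1 : L) else 0))) : GL (Fin 2) (mixedEmbedding.mixedSpace L))⁻¹ :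
        GL (Fin 2) (mixedEmbedding.mixedSpace L)) : Matrix (Fin 2) (Fin 2) (mixedEmbedding.mixedSpace L)).det := by
  obtain ⟨g, hg⟩ := isStablyConj_iff.1 h.1
  rw [← hg, _root_.mul_inv_rev, _root_.mul_inv_rev, inv_inv, ← mul_assoc, Units.val_mul, Units.val_mul, Matrix.det_units_conj]

/-- `τ`'s argument `−χ_g(γ₂) · det g⁻¹` is constant on stable classes of `H_∞`. [cite: Rogawski1990, §4.9 p. 55] -/
theorem archTauArg_of_isArchStablyConjH (h : IsArchStablyConjH L a a') : archTauArg L a' = archTauArg L a := by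
  unfold archTauArg
  rw [archCharpolyTwo_of_isArchStablyConjH L h, archGammaTwo_of_isArchStablyConjH L h, archDetInvFst_of_isArchStablyConjH L h]

/-- **`τ(γ_H)` is constant on stable classes of `H_∞`.** [cite: Rogawski1990, §4.9 p. 55] -/
theorem archTau_of_isArchStablyConjH (h : IsArchStablyConjH L a a') (μ : HeckeCharacter L) : archTau L a' μ = archTau L a μ := by
  unfold archTau
  rw [archGammaTwo_of_isArchStablyConjH L h, archTauArg_of_isArchStablyConjH L h]

open scoped Classical in
/-- **`D_{G∕H,∞}(γ_H)` is constant on stable classes of `H_∞`.** [cite: Rogawski1990, §4.9 p. 55] -/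
theorem archWeylRatio_of_isArchStablyConjH (h : IsArchStablyConjH L a a') : archWeylRatio L a' = archWeylRatio L a := by
  unfold archWeylRatio
  rw [archCharpolyTwo_of_isArchStablyConjH L h, archGammaTwo_of_isArchStablyConjH L h]

/-- `P_w(γ_H, γ′)` depends on `γ_H` only through `tr g_w`, `det g_w` — stable-class functions. [cite: Rogawski1990, §14.6 p. 242] -/
theorem archEigenlineProjector_of_isArchStablyConjH (h : IsArchStablyConjH L a a') (w : {w : InfinitePlace L // IsComplex w})
    (γ' : ↥(UnitaryGroup.arch (↥(maximalRealSubfield L)) L (IsCMField.complexConj L) 3 H')) :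
    archEigenlineProjector L H' a' w γ' = archEigenlineProjector L H' a w γ' := by
  have hc : ((((a'.1 : ↥(UnitaryGroup.arch (↥(maximalRealSubfield L)) L (IsCMField.complexConj L) 2
      (Matrix.of fun i j : Fin 2 => if i.val + j.val + 1 = 2 then (1 : L) else 0))) : GL (Fin 2) (mixedEmbedding.mixedSpace L)) :
        Matrix (Fin 2) (Fin 2) (mixedEmbedding.mixedSpace L)).map (UnitaryGroup.evalC L w)).charpoly =
      ((((a.1 : ↥(UnitaryGroup.arch (↥(maximalRealSubfield L)) L (IsCMField.complexConj L) 2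
      (Matrix.of fun i j : Fin 2 => if i.val + j.val + 1 = 2 then (1 : L) else 0))) : GL (Fin 2) (mixedEmbedding.mixedSpace L)) :
        Matrix (Fin 2) (Fin 2) (mixedEmbedding.mixedSpace L)).map (UnitaryGroup.evalC L w)).charpoly := by
    rw [Matrix.charpoly_map, Matrix.charpoly_map]
    exact congrArg _ (archCharpolyTwo_of_isArchStablyConjH L h)
  have htr := congrArg (fun p : Polynomial ℂ => -p.coeff (Fintype.card (Fin 2) - 1)) hc
  have hdet := congrArg (fun p : Polynomial ℂ => (-1 : ℂ) ^ Fintype.card (Fin 2) * p.coeff 0) hc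
  simp only [← Matrix.trace_eq_neg_charpoly_coeff, ← Matrix.det_eq_sign_charpoly_coeff] at htr hdet
  unfold archEigenlineProjector
  simp only [htr, hdet]

/-- `κ_w(γ_H, γ′)` is constant on stable classes of `γ_H`. [cite: Rogawski1990, §14.6 p. 242] [cite: LanglandsShelstad1987, §1] -/
theorem archKappaAt_of_isArchStablyConjH (h : IsArchStablyConjH L a a') (w : {w : InfinitePlace L // IsComplex w})
    (γ' : ↥(UnitaryGroup.arch (↥(maximalRealSubfield L)) L (IsCMField.complexConj L) 3 H')) :
    archKappaAt L H' a' w γ' = archKappaAt L H' a w γ' := by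
  unfold archKappaAt
  rw [archEigenlineProjector_of_isArchStablyConjH L H' h]

/-- `ι(γ_H′) ↔ γ′` iff `ι(γ_H) ↔ γ′` for `γ_H ∼_st γ_H′` (matching only sees the stable class of `γ_H`; ★ `EndoMatches.of_isStablyConjH_left`).
[cite: Rogawski1990, §4.3 p. 42; §14.1 p. 232] -/
theorem isArchNormPair_iff_of_isArchStablyConjH (h : IsArchStablyConjH L a a')
    (γ' : ↥(UnitaryGroup.arch (↥(maximalRealSubfield L)) L (IsCMField.complexConj L) 3 H')) :
    IsArchNormPair L H' a' γ' ↔ IsArchNormPair L H' a γ' :=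
  ⟨fun hm => EndoMatches.of_isStablyConjH_left hm (IsStablyConjH.symm h), fun hm => EndoMatches.of_isStablyConjH_left hm h⟩

open scoped Classical in
/-- **(Δ-STABLE) `Δ″_∞(γ_H′, γ′) = Δ″_∞(γ_H, γ′)` for `γ_H ∼_st γ_H′` in `H_∞`** — Rogawski's explicit archimedean factor is constant on STABLE classes of `γ_H`
(it reads `γ_H` through `γ₂`, `χ_g`, `det g⁻¹` and the `GL₃(L ⊗ ℝ)`-class of `ι(γ_H)` only). [cite: Rogawski1990, §4.9 p. 55; §14.6 p. 242] [cite: LanglandsShelstad1987, §1] -/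
theorem archExplicitDelta_of_isArchStablyConjH (h : IsArchStablyConjH L a a') (μ : HeckeCharacter L)
    (b : ↥(UnitaryGroup.arch (↥(maximalRealSubfield L)) L (IsCMField.complexConj L) 3 H')) :
    archExplicitDelta L H' a' μ b = archExplicitDelta L H' a μ b := by
  by_cases hb : IsArchNormPair L H' a b
  · rw [archExplicitDelta_of_isArchNormPair L H' _ μ ((isArchNormPair_iff_of_isArchStablyConjH L H' h b).2 hb),
      archExplicitDelta_of_isArchNormPair L H' _ μ hb, archTau_of_isArchStablyConjH L h, archWeylRatio_of_isArchStablyConjH L h]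
    simp only [archKappaAt_of_isArchStablyConjH L H' h]
  · rw [archExplicitDelta_of_not_isArchNormPair L H' _ μ (fun h' => hb ((isArchNormPair_iff_of_isArchStablyConjH L H' h b).1 h')),
      archExplicitDelta_of_not_isArchNormPair L H' _ μ hb]

/-- The same with the stable conjugacy hypothesis in the other order (`a′ ∼_st a`). [cite: Rogawski1990, §4.9 p. 55] [cite: LanglandsShelstad1987, §1] -/
theorem archExplicitDelta_of_isArchStablyConjH' (h : IsArchStablyConjH L a' a) (μ : HeckeCharacter L)
    (b : ↥(UnitaryGroup.arch (↥(maximalRealSubfield L)) L (IsCMField.complexConj L) 3 H')) :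
    archExplicitDelta L H' a' μ b = archExplicitDelta L H' a μ b :=
  archExplicitDelta_of_isArchStablyConjH L H' (IsStablyConjH.symm h) μ b

end Stable

/-! ## §2 On the Cartan atlas `endoTorus S c`: the flip `θ₀ ↔ θ₂` (compact place) and `x ↦ −x` (split place) stay in the stable class -/

section Swap

/-- The swap `J = (0 1; 1 0)` exchanges the entries of a diagonal torus element of `U(Φ₂)(ℂ)`'s compact Cartan: `J · diag(z₀, z₁) · J⁻¹ = diag(z₁, z₀)` (twin of ★
`swapGL_conj_hypBlockGL` for the compact block). [cite: Shelstad1979, §4 p. 23] [cite: Rogawski1990, §3.6 p. 31] -/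
theorem swapGL_conj_circleDiagonal_two (z₀ z₁ : Circle) :
    Matrix.GeneralLinearGroup.mkOfDetNeZero !![(0 : ℂ), 1; 1, 0] det_swapTwo_ne_zero * circleDiagonal 2 ![z₀, z₁] *
        (Matrix.GeneralLinearGroup.mkOfDetNeZero !![(0 : ℂ), 1; 1, 0] det_swapTwo_ne_zero)⁻¹ = circleDiagonal 2 ![z₁, z₀] := by
  rw [mul_inv_eq_iff_eq_mul]
  refine Matrix.GeneralLinearGroup.ext fun i j => ?_
  rw [Units.val_mul, Units.val_mul, coe_circleDiagonal, coe_circleDiagonal, Matrix.GeneralLinearGroup.val_mkOfDetNeZero]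
  fin_cases i <;> fin_cases j <;> simp [Matrix.mul_apply, Matrix.diagonal]

end Swap

section Atlas

variable (L : Type) [Field L] [NumberField L] [IsCMField L] (H' : Matrix (Fin 3) (Fin 3) L)
  [DecidableEq {w : InfinitePlace L // IsComplex w}]
  (S : Finset {w : InfinitePlace L // IsComplex w}) (c : {w : InfinitePlace L // IsComplex w} → Fin 3 → ℝ)

omit [NumberField L] [IsCMField L] [DecidableEq {w : InfinitePlace L // IsComplex w}] in
/-- The `U(Φ₁)_{w′}`-component reads only the coordinate `c w′ 1`. [cite: Rogawski1990, §4.9 p. 54] -/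
theorem endoCircle_congr {c c' : {w : InfinitePlace L // IsComplex w} → Fin 3 → ℝ} (w' : {w : InfinitePlace L // IsComplex w}) (h1 : c w' 1 = c' w' 1) :
    endoCircle L c w' = endoCircle L c' w' := by
  apply Subtype.ext
  apply Units.ext
  rw [coe_endoCircle, coe_endoCircle, h1]

omit [NumberField L] [IsCMField L] in
/-- The `U(Φ₁)`-components do not see the flip (`(flipAt w c) w′ 1 = c w′ 1`). [cite: Shelstad1979, §4 p. 23] -/
theorem endoCircle_flipAt (w : {w : InfinitePlace L // IsComplex w}) : endoCircle L (ArchCartan.flipAt w c) = endoCircle L c := by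
  funext w'
  refine endoCircle_congr L w' ?_
  by_cases hw : w' = w
  · subst hw
    rw [ArchCartan.flipAt_apply_self]
    rfl
  · rw [ArchCartan.flipAt_apply_of_ne hw]

omit [NumberField L] [IsCMField L] in
/-- The `U(Φ₁)`-components do not see `x ↦ −x` (`(negXAt w c) w′ 1 = c w′ 1`). [cite: Shelstad1979, §4 p. 23] -/
theorem endoCircle_negXAt (w : {w : InfinitePlace L // IsComplex w}) : endoCircle L (ArchCartan.negXAt w c) = endoCircle L c := by
  funext w'
  refine endoCircle_congr L w' ?_
  by_cases hw : w' = w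
  · subst hw
    rw [ArchCartan.negXAt_apply_self]
    rfl
  · rw [ArchCartan.negXAt_apply_of_ne hw]

omit [NumberField L] [IsCMField L] in
/-- The `U(Φ₂)_{w′}`-block reads only the coordinates `c w′ 0`, `c w′ 2` (★ `coe_endoBlock_of_mem` ∕ `_of_not_mem`). [cite: Rogawski1990, §3.6 p. 31; §8.2 p. 122] -/
theorem endoBlock_congr {c c' : {w : InfinitePlace L // IsComplex w} → Fin 3 → ℝ} (w' : {w : InfinitePlace L // IsComplex w})
    (h0 : c w' 0 = c' w' 0) (h2 : c w' 2 = c' w' 2) : endoBlock L S c w' = endoBlock L S c' w' := by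
  apply Subtype.ext
  apply Units.ext
  by_cases hS : w' ∈ S
  · rw [coe_endoBlock_of_mem L c hS, coe_endoBlock_of_mem L c' hS, h0, h2]
  · rw [coe_endoBlock_of_not_mem L c hS, coe_endoBlock_of_not_mem L c' hS, h0, h2]

omit [NumberField L] [IsCMField L] in
/-- The `U(Φ₂)_{w′}`-blocks at `w′ ≠ w` do not see the flip at `w`. [cite: Shelstad1979, §4 p. 23] -/
theorem endoBlock_flipAt_of_ne {w w' : {w : InfinitePlace L // IsComplex w}} (h : w' ≠ w) :
    endoBlock L S (ArchCartan.flipAt w c) w' = endoBlock L S c w' :=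
  endoBlock_congr L S w' (by rw [ArchCartan.flipAt_apply_of_ne h]) (by rw [ArchCartan.flipAt_apply_of_ne h])

omit [NumberField L] [IsCMField L] in
/-- The `U(Φ₂)_{w′}`-blocks at `w′ ≠ w` do not see `x ↦ −x` at `w`. [cite: Shelstad1979, §4 p. 23] -/
theorem endoBlock_negXAt_of_ne {w w' : {w : InfinitePlace L // IsComplex w}} (h : w' ≠ w) :
    endoBlock L S (ArchCartan.negXAt w c) w' = endoBlock L S c w' :=
  endoBlock_congr L S w' (by rw [ArchCartan.negXAt_apply_of_ne h]) (by rw [ArchCartan.negXAt_apply_of_ne h])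

omit [NumberField L] [IsCMField L] in
/-- At a COMPACT place `w ∉ S` the flipped block `P·diag(e^{iθ₂}, e^{iθ₀})·P⁻¹` is `GL₂(ℂ)`-conjugate (by `PJP⁻¹`) to `P·diag(e^{iθ₀}, e^{iθ₂})·P⁻¹`.
[cite: Shelstad1979, §4 p. 23] [cite: Rogawski1990, §3.1 p. 19] -/
theorem isStablyConj_endoBlock_flipAt {w : {w : InfinitePlace L // IsComplex w}} (hw : w ∉ S) :
    IsStablyConj (starRingEnd ℂ) ((Matrix.of fun i j : Fin 2 => if i.val + j.val + 1 = 2 then (1 : L) else 0).map w.1.embedding)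
      (endoBlock L S c w) (endoBlock L S (ArchCartan.flipAt w c) w) := by
  have e0 : ArchCartan.flipAt w c w 0 = c w 2 := by simp
  have e2 : ArchCartan.flipAt w c w 2 = c w 0 := by simp
  have h0 : ∀ c' : {w : InfinitePlace L // IsComplex w} → Fin 3 → ℝ, (endoBlock L S c' w : GL (Fin 2) ℂ) =
      Matrix.GeneralLinearGroup.mkOfDetNeZero !![(1 : ℂ), 1; 1, -1] det_cayleyTwo_ne_zero * circleDiagonal 2 ![Circle.exp (c' w 0), Circle.exp (c' w 2)] *
        (Matrix.GeneralLinearGroup.mkOfDetNeZero !![(1 : ℂ), 1; 1, -1] det_cayleyTwo_ne_zero)⁻¹ := fun c' => by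
    unfold endoBlock; rw [if_neg hw]
  refine isStablyConj_iff.2
    ⟨Matrix.GeneralLinearGroup.mkOfDetNeZero !![(1 : ℂ), 1; 1, -1] det_cayleyTwo_ne_zero *
        Matrix.GeneralLinearGroup.mkOfDetNeZero !![(0 : ℂ), 1; 1, 0] det_swapTwo_ne_zero *
      (Matrix.GeneralLinearGroup.mkOfDetNeZero !![(1 : ℂ), 1; 1, -1] det_cayleyTwo_ne_zero)⁻¹, ?_⟩
  rw [h0 c, h0 (ArchCartan.flipAt w c), e0, e2]
  have key := swapGL_conj_circleDiagonal_two (Circle.exp (c w 0)) (Circle.exp (c w 2))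
  generalize (Matrix.GeneralLinearGroup.mkOfDetNeZero !![(1 : ℂ), 1; 1, -1] det_cayleyTwo_ne_zero : GL (Fin 2) ℂ) = P at key ⊢
  generalize (Matrix.GeneralLinearGroup.mkOfDetNeZero !![(0 : ℂ), 1; 1, 0] det_swapTwo_ne_zero : GL (Fin 2) ℂ) = σ at key ⊢
  calc P * σ * P⁻¹ * (P * circleDiagonal 2 ![Circle.exp (c w 0), Circle.exp (c w 2)] * P⁻¹) * (P * σ * P⁻¹)⁻¹
      = P * (σ * circleDiagonal 2 ![Circle.exp (c w 0), Circle.exp (c w 2)] * σ⁻¹) * P⁻¹ := by group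
    _ = P * circleDiagonal 2 ![Circle.exp (c w 2), Circle.exp (c w 0)] * P⁻¹ := by rw [key]

omit [NumberField L] [IsCMField L] in
/-- At a SPLIT place `w ∈ S` the reflected block `diag(e^{−x+iθ}, e^{x+iθ})` is `GL₂(ℂ)`-conjugate (by the swap `J`, ★ `swapGL_conj_hypBlockGL`) to `diag(e^{x+iθ}, e^{−x+iθ})`.
[cite: Shelstad1979, §4 p. 23] [cite: Rogawski1990, §3.6 p. 31] -/
theorem isStablyConj_endoBlock_negXAt {w : {w : InfinitePlace L // IsComplex w}} (hw : w ∈ S) :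
    IsStablyConj (starRingEnd ℂ) ((Matrix.of fun i j : Fin 2 => if i.val + j.val + 1 = 2 then (1 : L) else 0).map w.1.embedding)
      (endoBlock L S c w) (endoBlock L S (ArchCartan.negXAt w c) w) := by
  have e0 : ArchCartan.negXAt w c w 0 = -c w 0 := by simp
  have e2 : ArchCartan.negXAt w c w 2 = c w 2 := by simp
  have h0 : ∀ c' : {w : InfinitePlace L // IsComplex w} → Fin 3 → ℝ, (endoBlock L S c' w : GL (Fin 2) ℂ) = hypBlockGL (c' w 0) (c' w 2) := fun c' => by
    unfold endoBlock; rw [if_pos hw]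
  refine isStablyConj_iff.2 ⟨Matrix.GeneralLinearGroup.mkOfDetNeZero !![(0 : ℂ), 1; 1, 0] det_swapTwo_ne_zero, ?_⟩
  rw [h0 c, h0 (ArchCartan.negXAt w c), e0, e2]
  exact swapGL_conj_hypBlockGL _ _

/-- **The flip `θ₀ ↔ θ₂` at a compact place keeps `endoTorus S c` in its stable class**: `endoTorus S c ∼_st endoTorus S (flipAt w c)` in `H_∞` (`w ∉ S`).
[cite: Shelstad1979, §4 p. 23] [cite: Rogawski1990, §3.1 p. 19] -/
theorem isArchStablyConjH_endoTorus_flipAt {w : {w : InfinitePlace L // IsComplex w}} (hw : w ∉ S) :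
    IsArchStablyConjH L (endoTorus L S c) (endoTorus L S (ArchCartan.flipAt w c)) := by
  refine ⟨?_, ?_⟩
  · rw [isStablyConj_arch_iff_forall_place]
    intro w'
    rw [archPiEquivCM_endoTorus_fst, archPiEquivCM_endoTorus_fst]
    by_cases hw' : w' = w
    · subst hw'
      exact isStablyConj_endoBlock_flipAt L S c hw
    · rw [endoBlock_flipAt_of_ne L S c hw']
      exact IsStablyConj.refl _
  · have h2 : (endoTorus L S (ArchCartan.flipAt w c)).2 = (endoTorus L S c).2 := by
      show (archPiEquivCM 1 L (Matrix.of fun i j : Fin 1 => if i.val + j.val + 1 = 1 then (1 : L) else 0)).symm (endoCircle L (ArchCartan.flipAt w c)) =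
        (archPiEquivCM 1 L (Matrix.of fun i j : Fin 1 => if i.val + j.val + 1 = 1 then (1 : L) else 0)).symm (endoCircle L c)
      rw [endoCircle_flipAt]
    rw [h2]
    exact IsStablyConj.refl _

/-- **`x ↦ −x` at a split place keeps `endoTorus S c` in its stable class**: `endoTorus S c ∼_st endoTorus S (negXAt w c)` in `H_∞` (`w ∈ S`).
[cite: Shelstad1979, §4 p. 23] [cite: Rogawski1990, §3.1 p. 19] -/
theorem isArchStablyConjH_endoTorus_negXAt {w : {w : InfinitePlace L // IsComplex w}} (hw : w ∈ S) :
    IsArchStablyConjH L (endoTorus L S c) (endoTorus L S (ArchCartan.negXAt w c)) := by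
  refine ⟨?_, ?_⟩
  · rw [isStablyConj_arch_iff_forall_place]
    intro w'
    rw [archPiEquivCM_endoTorus_fst, archPiEquivCM_endoTorus_fst]
    by_cases hw' : w' = w
    · subst hw'
      exact isStablyConj_endoBlock_negXAt L S c hw
    · rw [endoBlock_negXAt_of_ne L S c hw']
      exact IsStablyConj.refl _
  · have h2 : (endoTorus L S (ArchCartan.negXAt w c)).2 = (endoTorus L S c).2 := by
      show (archPiEquivCM 1 L (Matrix.of fun i j : Fin 1 => if i.val + j.val + 1 = 1 then (1 : L) else 0)).symm (endoCircle L (ArchCartan.negXAt w c)) =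
        (archPiEquivCM 1 L (Matrix.of fun i j : Fin 1 => if i.val + j.val + 1 = 1 then (1 : L) else 0)).symm (endoCircle L c)
      rw [endoCircle_negXAt]
    rw [h2]
    exact IsStablyConj.refl _

/-- **(Δ-STABLE on the atlas, compact place) `Δ″_∞(endoTorus S (flipAt w c), γ′) = Δ″_∞(endoTorus S c, γ′)`** for `w ∉ S` — the (W)-clause input: the
non-realised Weyl flip of the compact `U(Φ₂)_w`-torus does not change Rogawski's factor. [cite: Rogawski1990, §4.9 p. 55; §14.6 p. 242] [cite: Shelstad1979, §4 p. 23] -/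
theorem archExplicitDelta_endoTorus_flipAt {w : {w : InfinitePlace L // IsComplex w}} (hw : w ∉ S) (μ : HeckeCharacter L)
    (b : ↥(UnitaryGroup.arch (↥(maximalRealSubfield L)) L (IsCMField.complexConj L) 3 H')) :
    archExplicitDelta L H' (endoTorus L S (ArchCartan.flipAt w c)) μ b = archExplicitDelta L H' (endoTorus L S c) μ b :=
  archExplicitDelta_of_isArchStablyConjH L H' (isArchStablyConjH_endoTorus_flipAt L S c hw) μ b

/-- **(Δ-STABLE on the atlas, split place) `Δ″_∞(endoTorus S (negXAt w c), γ′) = Δ″_∞(endoTorus S c, γ′)`** for `w ∈ S` — the real reflection `x ↦ −x` of the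
split `U(Φ₂)_w`-torus does not change Rogawski's factor. [cite: Rogawski1990, §4.9 p. 55; §14.6 p. 242] [cite: Shelstad1979, §4 p. 23] -/
theorem archExplicitDelta_endoTorus_negXAt {w : {w : InfinitePlace L // IsComplex w}} (hw : w ∈ S) (μ : HeckeCharacter L)
    (b : ↥(UnitaryGroup.arch (↥(maximalRealSubfield L)) L (IsCMField.complexConj L) 3 H')) :
    archExplicitDelta L H' (endoTorus L S (ArchCartan.negXAt w c)) μ b = archExplicitDelta L H' (endoTorus L S c) μ b :=
  archExplicitDelta_of_isArchStablyConjH L H' (isArchStablyConjH_endoTorus_negXAt L S c hw) μ b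

end Atlas

end Literature.NumberTheory.Rogawski1990

end
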